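import Mathlib
import Summits.NavierStokesRegularity.NavierStokesRegularity.Theorems.LerayQuarterDissipationFiniteDissipationLiouvilleVorticityAmplitudeJoint
import Summits.NavierStokesRegularity.NavierStokesRegularity.Theorems.LerayQuarterDissipationFiniteDissipationLiouvilleVorticityAmplitudeThreshold
import Summits.NavierStokesRegularity.NavierStokesRegularity.Theorems.LerayQuarterDissipationFiniteDissipationLiouvilleThresholdOneDss
import Summits.NavierStokesRegularity.NavierStokesRegularity.Theorems.LerayQuarterDissipationFiniteDissipationLiouvilleProvedRegion
import Summits.NavierStokesRegularity.NavierStokesRegularity.Theorems.LerayQuarterDissipationFiniteDissipationLiouvilleThresholdK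
import HarnessLib

/-!
# Crux `FiniteDissipationLiouville` (stmt-NavierStokesRegularity-22144): the DSS WALL on the stratum
# below the vorticity-amplitude collar and on the joint region, EVERY FACTOR; and the proved region of
# the crux in its three scale-invariant parameters `(C, K, C_ω)` (bookkeeping)

Theorems file of route `LerayQuarterDissipation` (lead prover g15; `--supports` the crux; corollaries of
`…VorticityAmplitudeThreshold` / `…VorticityAmplitudeJoint` with `…ThresholdOneDss`). Navier–Stokes
regularity is NOT proved by anything here; no summit is.

The route's DSS wall (`∀ c > 1, TypeIDSSLiouville c`, Bradshaw–Tsai OP 5.1) is NECESSARY for the crux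
(`…Hardness`). On the stratum a past-DSS member that is regular at the apex vanishes
(`ThresholdOne.eq_zero_of_pastDss_of_not_singular`). Hence, with the scale-invariant vorticity
amplitude `C_ω ≥ (−t)‖curl V(t,x)‖`:

* `eq_zero_of_pastDss_of_vorticity_le` — **a member of `𝒟_{C,K}` with `(−t)‖curl V‖ ≤ √3/4`
  everywhere which is discretely self-similar on the past with ANY factor `c > 1` vanishes identically**;
* `exists_gap_eq_zero_of_pastDss_of_vorticity_le` — `∀ C K ∃ ε > 0`: the same below the collar
  `√3/4 + ε`;
* `eq_zero_of_pastDss_of_joint` — the same on the joint region `λ²C² + (1−λ)(4/√3)C_ω < 1` (here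
  indeed `V ≡ 0` for every member, DSS or not: `eq_zero_of_joint`; recorded for the wall's bookkeeping);
* `exists_gaps_not_singular_of_region` — **THE PROVED REGION in `(C, K, C_ω)`**: for all `C, K` there
  are `ε, ε', ε'' > 0` such that a member of `𝒟_{C,K}` with vorticity amplitude `≤ C_ω` lying in
  `{C ≤ 1 + ε} ∪ {θ(K)⁴ ≤ 64/27 + ε'} ∪ {C_ω ≤ √3/4 + ε''} ∪ {∃λ∈(0,1], λ²C² + (1−λ)(4/√3)C_ω < 1}`
  (`θ(K) = √(max K 0)(√K_S)³`) is NOT singular at the apex — union of `ThresholdOne.exists_typeI_gap`,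
  `ThresholdK.exists_dissipation_gap`, `exists_vorticity_gap`, `not_singular_of_joint`.

HONEST FRAMING: bookkeeping; the collars are ineffective (compactness); outside the union the crux is
FRONTIER; nothing here bears on Navier–Stokes regularity or blow-up.

References: Bradshaw–Tsai, Ann. Henri Poincaré 18 (2017) OP 5.1; Koch–Nadirashvili–Seregin–Šverák 2009.
-/

noncomputable section

set_option linter.dupNamespace false

namespace Summit.NavierStokesRegularity.NavierStokesRegularity.Theorems.FiniteDissipationLiouville.VorticityAmplitude

open MeasureTheory Set Filter Topology Metric Function
open Literature.Analysis Literature.Analysis.FluidPDE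
open Summit.NavierStokesRegularity.NavierStokesRegularity.Theorems
open Summit.NavierStokesRegularity.NavierStokesRegularity.Theorems.FiniteDissipationLiouville

/-- **THE DSS WALL ON THE STRATUM AT THE VORTICITY THRESHOLD, EVERY FACTOR.** A member of `𝒟_{C,K}`
with `(−t)‖curl V(t,x)‖ ≤ √3/4` for all `t < 0`, `x`, which is discretely self-similar on the past
with some factor `c > 1`, vanishes identically (`not_singular_of_vorticity_le` + regular past-DSS
members vanish). [cite: KochNadirashviliSereginSverak2009, §4 (arXiv:0709.3599 p. 8)] -/
theorem eq_zero_of_pastDss_of_vorticity_le {C K c : ℝ}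
    {W : ℝ → EuclideanSpace ℝ (Fin 3) → EuclideanSpace ℝ (Fin 3)} (hW : IsTypeIAncientMild C W)
    (hlaw : ∀ s : ℝ, s < 0 → ∫⁻ x, ‖fderiv ℝ (W s) x‖ₑ ^ 2 ≤ ENNReal.ofReal (K / Real.sqrt (-s)))
    (hω : ∀ t : ℝ, t < 0 → ∀ x, (-t) * ‖curl (W t) x‖ ≤ Real.sqrt 3 / 4)
    (hc : 1 < c) (hdss : ∀ t : ℝ, t < 0 → ∀ x, c • W (c ^ 2 * t) (c • x) = W t x) :
    ∀ t < 0, ∀ x, W t x = 0 :=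
  ThresholdOne.eq_zero_of_pastDss_of_not_singular hW hlaw hc hdss
    (not_singular_of_vorticity_le hW hlaw hω)

/-- **THE DSS WALL ON THE STRATUM BELOW THE VORTICITY COLLAR, EVERY FACTOR.** For all `C, K` there is
`ε > 0` such that every member of `𝒟_{C,K}` with `(−t)‖curl V‖ ≤ √3/4 + ε` everywhere which is
discretely self-similar on the past with some factor `c > 1` vanishes identically. [cite: KochNadirashviliSereginSverak2009, §4 (arXiv:0709.3599 p. 8)] -/
theorem exists_gap_eq_zero_of_pastDss_of_vorticity_le (C K : ℝ) : ∃ ε : ℝ, 0 < ε ∧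
    ∀ (c : ℝ) (W : ℝ → EuclideanSpace ℝ (Fin 3) → EuclideanSpace ℝ (Fin 3)), 1 < c →
      IsTypeIAncientMild C W →
      (∀ s : ℝ, s < 0 → ∫⁻ x, ‖fderiv ℝ (W s) x‖ₑ ^ 2 ≤ ENNReal.ofReal (K / Real.sqrt (-s))) →
      (∀ t : ℝ, t < 0 → ∀ x, (-t) * ‖curl (W t) x‖ ≤ Real.sqrt 3 / 4 + ε) →
      (∀ t : ℝ, t < 0 → ∀ x, c • W (c ^ 2 * t) (c • x) = W t x) →
      ∀ t < 0, ∀ x, W t x = 0 := by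
  obtain ⟨ε, hε, hgap⟩ := exists_vorticity_gap C K
  exact ⟨ε, hε, fun c W hc hW hlaw hω hdss =>
    ThresholdOne.eq_zero_of_pastDss_of_not_singular hW hlaw hc hdss (hgap W hW hlaw hω)⟩

/-- **The DSS wall on the joint region** (indeed every member there vanishes, `eq_zero_of_joint`;
recorded in the wall's own quantifier shape). [folklore] -/
theorem eq_zero_of_pastDss_of_joint {C K c : ℝ}
    {W : ℝ → EuclideanSpace ℝ (Fin 3) → EuclideanSpace ℝ (Fin 3)} (hW : IsTypeIAncientMild C W)
    (hlaw : ∀ s : ℝ, s < 0 → ∫⁻ x, ‖fderiv ℝ (W s) x‖ₑ ^ 2 ≤ ENNReal.ofReal (K / Real.sqrt (-s)))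
    {Cω : ℝ} (hω : ∀ t : ℝ, t < 0 → ∀ x, (-t) * ‖curl (W t) x‖ ≤ Cω)
    {lam : ℝ} (hlam0 : 0 < lam) (hlam1 : lam ≤ 1)
    (hjoint : lam ^ 2 * C ^ 2 + (1 - lam) * (4 * Cω * Real.sqrt 3 / 3) < 1)
    (_hc : 1 < c) (_hdss : ∀ t : ℝ, t < 0 → ∀ x, c • W (c ^ 2 * t) (c • x) = W t x) :
    ∀ t < 0, ∀ x, W t x = 0 :=
  eq_zero_of_joint hW hlaw hω hlam0 hlam1 hjoint

/-- **THE PROVED REGION OF `FiniteDissipationLiouville` IN `(C, K, C_ω)`.** For all `C, K` there are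
`ε, ε', ε'' > 0` such that every Type-I ancient mild `ū` (KNSS gauge, constant `C`) obeying the
quarter-rate law (constant `K`) with vorticity amplitude `(−t)‖curl ū(t,x)‖ ≤ C_ω` and lying in the
region `C ≤ 1 + ε ∨ θ(K)⁴ ≤ 64/27 + ε' ∨ C_ω ≤ √3/4 + ε'' ∨ (∃ λ ∈ (0,1], λ²C² + (1−λ)(4/√3)C_ω < 1)`
is NOT singular at the apex. (Union of the four landed regions; bookkeeping.) -/
theorem exists_gaps_not_singular_of_region (C K : ℝ) : ∃ ε : ℝ, 0 < ε ∧ ∃ ε' : ℝ, 0 < ε' ∧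
    ∃ ε'' : ℝ, 0 < ε'' ∧
    ∀ (ū : ℝ → EuclideanSpace ℝ (Fin 3) → EuclideanSpace ℝ (Fin 3)) (Cω : ℝ),
      IsTypeIAncientMild C ū →
      (∀ s : ℝ, s < 0 → ∫⁻ x, ‖fderiv ℝ (ū s) x‖ₑ ^ 2 ≤ ENNReal.ofReal (K / Real.sqrt (-s))) →
      (∀ t : ℝ, t < 0 → ∀ x, (-t) * ‖curl (ū t) x‖ ≤ Cω) →
      (C ≤ 1 + ε ∨
        (Real.sqrt (max K 0) *
          Real.sqrt (SNormLESNormFDerivOfEqConst (EuclideanSpace ℝ (Fin 3))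
            (volume : Measure (EuclideanSpace ℝ (Fin 3))) 2 : ℝ) ^ 3) ^ 4 ≤ 64 / 27 + ε' ∨
        Cω ≤ Real.sqrt 3 / 4 + ε'' ∨
        (∃ lam : ℝ, 0 < lam ∧ lam ≤ 1 ∧ lam ^ 2 * C ^ 2 + (1 - lam) * (4 * Cω * Real.sqrt 3 / 3) < 1)) →
      ¬ (∀ r > 0, ∀ M : ℝ, ∃ t ∈ Set.Ioo (-(r ^ 2)) (0 : ℝ),
        ∃ x ∈ Metric.ball (0 : EuclideanSpace ℝ (Fin 3)) r, M < ‖ū t x‖) := by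
  obtain ⟨ε, hε, hgap⟩ := ThresholdOne.exists_typeI_gap K
  obtain ⟨ε', hε', hgap'⟩ := ThresholdK.exists_dissipation_gap C
  obtain ⟨ε'', hε'', hgap''⟩ := exists_vorticity_gap C K
  refine ⟨ε, hε, ε', hε', ε'', hε'', fun ū Cω hū hK hω h => ?_⟩
  rcases h with h | h | h | ⟨lam, h0, h1, hj⟩
  · exact hgap C h ū hū hK
  · exact hgap' K h ū hū hK
  · exact hgap'' ū hū hK fun t ht x => (hω t ht x).trans h
  · exact not_singular_of_joint hū hK hω h0 h1 hj

end Summit.NavierStokesRegularity.NavierStokesRegularity.Theorems.FiniteDissipationLiouville.VorticityAmplitude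

end
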